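import Mathlib
import HarnessLib
import Summits.RiemannHypothesis.RiemannHypothesis.Theorems.DbrWallLogTableC

/-!
# DBR column, rung B-P(P1): two-sided rational enclosures of `log p`, primes `p ≤ 347` (part D: 239 ≤ p ≤ 347)

RH-FREE elementary inequalities (LINE 1 of the label discipline): for each prime `p` in range a lemma
`log_<p>_bounds : lo < Real.log p ∧ Real.log p < hi` with 13-decimal rational `lo, hi` (widths `≤ 1e-12`),
each obtained from Mathlib's `Real.abs_log_sub_add_sum_range_le` (the logarithmic series with remainder)
applied to `log(p/N)` for a smooth neighbour `N` of `p`, plus the bounds already proved for the primes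
dividing `N`. They feed the generic anti-persistence rung certificate (`DbrWallRungKit`): the prime terms
`Λ(n)n^{-1/2}(log q' − log n)` of the two-point gap `2Ψ(s) − Ψ(2s)` at `s = (log q')/2` are bounded below
from these enclosures. Nothing here bears on the truth of RH. [folklore]
-/

set_option linter.dupNamespace false

noncomputable section

namespace Summit.RiemannHypothesis.RiemannHypothesis.Theorems.DbrWall.LogTable

/-- `5.4764635519310 < log 239 < 5.4764635519321` (from `log(238 / 239)` by 5 terms of the logarithmic series; width 1.1e-12). [folklore] -/
theorem log_239_bounds : (5.4764635519310 : ℝ) < Real.log 239 ∧ Real.log 239 < 5.4764635519321 := by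
  have hx : |(1 / 239 : ℝ)| < 1 := by rw [abs_of_pos (by norm_num)]; norm_num
  have h := Real.abs_log_sub_add_sum_range_le hx 5
  have hN : Real.log (238 : ℝ) = Real.log 2 + Real.log 7 + Real.log 17 := by
    rw [show (238 : ℝ) = 2 * 7 * 17 by norm_num]
    rw [Real.log_mul (by positivity) (by positivity), Real.log_mul (by positivity) (by positivity)]
  have e : Real.log (1 - 1 / 239 : ℝ) = (Real.log 2 + Real.log 7 + Real.log 17) - Real.log 239 := by
    rw [show (1 - 1 / 239 : ℝ) = (238 : ℝ) / 239 by norm_num, Real.log_div (by norm_num) (by norm_num), hN]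
  rw [e, abs_of_pos (by norm_num : (0:ℝ) < 1 / 239)] at h
  obtain ⟨hl, hu⟩ := abs_le.1 h
  simp only [Finset.sum_range_succ, Finset.sum_range_zero] at hl hu
  norm_num at hl hu
  have hb2 := log_two_bounds
  have hb7 := log_seven_bounds
  have hb17 := log_seventeen_bounds
  constructor <;> linarith

/-- `5.4847969334902 < log 241 < 5.4847969334914` (from `log(241 / 242)` by 5 terms of the logarithmic series; width 1.2e-12). [folklore] -/
theorem log_241_bounds : (5.4847969334902 : ℝ) < Real.log 241 ∧ Real.log 241 < 5.4847969334914 := by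
  have hx : |(1 / 242 : ℝ)| < 1 := by rw [abs_of_pos (by norm_num)]; norm_num
  have h := Real.abs_log_sub_add_sum_range_le hx 5
  have hN : Real.log (242 : ℝ) = Real.log 2 + 2 * Real.log 11 := by
    rw [show (242 : ℝ) = 2 * 11 ^ 2 by norm_num]
    rw [Real.log_mul (by positivity) (by positivity)]
    simp only [Real.log_pow]; push_cast; ring
  have e : Real.log (1 - 1 / 242 : ℝ) = Real.log 241 - (Real.log 2 + 2 * Real.log 11) := by
    rw [show (1 - 1 / 242 : ℝ) = (241 : ℝ) / 242 by norm_num, Real.log_div (by norm_num) (by norm_num), hN]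
  rw [e, abs_of_pos (by norm_num : (0:ℝ) < 1 / 242)] at h
  obtain ⟨hl, hu⟩ := abs_le.1 h
  simp only [Finset.sum_range_succ, Finset.sum_range_zero] at hl hu
  norm_num at hl hu
  have hb2 := log_two_bounds
  have hb11 := log_eleven_bounds
  constructor <;> linarith

/-- `5.5254529391314 < log 251 < 5.5254529391325` (from `log(250 / 251)` by 5 terms of the logarithmic series; width 1.1e-12). [folklore] -/
theorem log_251_bounds : (5.5254529391314 : ℝ) < Real.log 251 ∧ Real.log 251 < 5.5254529391325 := by
  have hx : |(1 / 251 : ℝ)| < 1 := by rw [abs_of_pos (by norm_num)]; norm_num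
  have h := Real.abs_log_sub_add_sum_range_le hx 5
  have hN : Real.log (250 : ℝ) = Real.log 2 + 3 * Real.log 5 := by
    rw [show (250 : ℝ) = 2 * 5 ^ 3 by norm_num]
    rw [Real.log_mul (by positivity) (by positivity)]
    simp only [Real.log_pow]; push_cast; ring
  have e : Real.log (1 - 1 / 251 : ℝ) = (Real.log 2 + 3 * Real.log 5) - Real.log 251 := by
    rw [show (1 - 1 / 251 : ℝ) = (250 : ℝ) / 251 by norm_num, Real.log_div (by norm_num) (by norm_num), hN]
  rw [e, abs_of_pos (by norm_num : (0:ℝ) < 1 / 251)] at h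
  obtain ⟨hl, hu⟩ := abs_le.1 h
  simp only [Finset.sum_range_succ, Finset.sum_range_zero] at hl hu
  norm_num at hl hu
  have hb2 := log_two_bounds
  have hb5 := log_five_bounds
  constructor <;> linarith

/-- `5.5490760848948 < log 257 < 5.5490760848957` (from `log(256 / 257)` by 5 terms of the logarithmic series; width 9.0e-13). [folklore] -/
theorem log_257_bounds : (5.5490760848948 : ℝ) < Real.log 257 ∧ Real.log 257 < 5.5490760848957 := by
  have hx : |(1 / 257 : ℝ)| < 1 := by rw [abs_of_pos (by norm_num)]; norm_num
  have h := Real.abs_log_sub_add_sum_range_le hx 5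
  have hN : Real.log (256 : ℝ) = 8 * Real.log 2 := by
    rw [show (256 : ℝ) = 2 ^ 8 by norm_num]
    simp only [Real.log_pow]; push_cast; ring
  have e : Real.log (1 - 1 / 257 : ℝ) = (8 * Real.log 2) - Real.log 257 := by
    rw [show (1 - 1 / 257 : ℝ) = (256 : ℝ) / 257 by norm_num, Real.log_div (by norm_num) (by norm_num), hN]
  rw [e, abs_of_pos (by norm_num : (0:ℝ) < 1 / 257)] at h
  obtain ⟨hl, hu⟩ := abs_le.1 h
  simp only [Finset.sum_range_succ, Finset.sum_range_zero] at hl hu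
  norm_num at hl hu
  have hb2 := log_two_bounds
  constructor <;> linarith

/-- `5.5721540321772 < log 263 < 5.5721540321785` (from `log(262 / 263)` by 5 terms of the logarithmic series; width 1.3e-12). [folklore] -/
theorem log_263_bounds : (5.5721540321772 : ℝ) < Real.log 263 ∧ Real.log 263 < 5.5721540321785 := by
  have hx : |(1 / 263 : ℝ)| < 1 := by rw [abs_of_pos (by norm_num)]; norm_num
  have h := Real.abs_log_sub_add_sum_range_le hx 5
  have hN : Real.log (262 : ℝ) = Real.log 2 + Real.log 131 := by
    rw [show (262 : ℝ) = 2 * 131 by norm_num]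
    rw [Real.log_mul (by positivity) (by positivity)]
  have e : Real.log (1 - 1 / 263 : ℝ) = (Real.log 2 + Real.log 131) - Real.log 263 := by
    rw [show (1 - 1 / 263 : ℝ) = (262 : ℝ) / 263 by norm_num, Real.log_div (by norm_num) (by norm_num), hN]
  rw [e, abs_of_pos (by norm_num : (0:ℝ) < 1 / 263)] at h
  obtain ⟨hl, hu⟩ := abs_le.1 h
  simp only [Finset.sum_range_succ, Finset.sum_range_zero] at hl hu
  norm_num at hl hu
  have hb2 := log_two_bounds
  have hb131 := log_hundredthirtyone_bounds
  constructor <;> linarith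

/-- `5.5947113796013 < log 269 < 5.5947113796024` (from `log(268 / 269)` by 5 terms of the logarithmic series; width 1.1e-12). [folklore] -/
theorem log_269_bounds : (5.5947113796013 : ℝ) < Real.log 269 ∧ Real.log 269 < 5.5947113796024 := by
  have hx : |(1 / 269 : ℝ)| < 1 := by rw [abs_of_pos (by norm_num)]; norm_num
  have h := Real.abs_log_sub_add_sum_range_le hx 5
  have hN : Real.log (268 : ℝ) = 2 * Real.log 2 + Real.log 67 := by
    rw [show (268 : ℝ) = 2 ^ 2 * 67 by norm_num]
    rw [Real.log_mul (by positivity) (by positivity)]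
    simp only [Real.log_pow]; push_cast; ring
  have e : Real.log (1 - 1 / 269 : ℝ) = (2 * Real.log 2 + Real.log 67) - Real.log 269 := by
    rw [show (1 - 1 / 269 : ℝ) = (268 : ℝ) / 269 by norm_num, Real.log_div (by norm_num) (by norm_num), hN]
  rw [e, abs_of_pos (by norm_num : (0:ℝ) < 1 / 269)] at h
  obtain ⟨hl, hu⟩ := abs_le.1 h
  simp only [Finset.sum_range_succ, Finset.sum_range_zero] at hl hu
  norm_num at hl hu
  have hb2 := log_two_bounds
  have hb67 := log_sixtyseven_bounds
  constructor <;> linarith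

/-- `5.6021188208793 < log 271 < 5.6021188208803` (from `log(271 / 272)` by 5 terms of the logarithmic series; width 1.0e-12). [folklore] -/
theorem log_271_bounds : (5.6021188208793 : ℝ) < Real.log 271 ∧ Real.log 271 < 5.6021188208803 := by
  have hx : |(1 / 272 : ℝ)| < 1 := by rw [abs_of_pos (by norm_num)]; norm_num
  have h := Real.abs_log_sub_add_sum_range_le hx 5
  have hN : Real.log (272 : ℝ) = 4 * Real.log 2 + Real.log 17 := by
    rw [show (272 : ℝ) = 2 ^ 4 * 17 by norm_num]
    rw [Real.log_mul (by positivity) (by positivity)]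
    simp only [Real.log_pow]; push_cast; ring
  have e : Real.log (1 - 1 / 272 : ℝ) = Real.log 271 - (4 * Real.log 2 + Real.log 17) := by
    rw [show (1 - 1 / 272 : ℝ) = (271 : ℝ) / 272 by norm_num, Real.log_div (by norm_num) (by norm_num), hN]
  rw [e, abs_of_pos (by norm_num : (0:ℝ) < 1 / 272)] at h
  obtain ⟨hl, hu⟩ := abs_le.1 h
  simp only [Finset.sum_range_succ, Finset.sum_range_zero] at hl hu
  norm_num at hl hu
  have hb2 := log_two_bounds
  have hb17 := log_seventeen_bounds
  constructor <;> linarith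

/-- `5.6240175061867 < log 277 < 5.6240175061880` (from `log(277 / 278)` by 5 terms of the logarithmic series; width 1.3e-12). [folklore] -/
theorem log_277_bounds : (5.6240175061867 : ℝ) < Real.log 277 ∧ Real.log 277 < 5.6240175061880 := by
  have hx : |(1 / 278 : ℝ)| < 1 := by rw [abs_of_pos (by norm_num)]; norm_num
  have h := Real.abs_log_sub_add_sum_range_le hx 5
  have hN : Real.log (278 : ℝ) = Real.log 2 + Real.log 139 := by
    rw [show (278 : ℝ) = 2 * 139 by norm_num]
    rw [Real.log_mul (by positivity) (by positivity)]
  have e : Real.log (1 - 1 / 278 : ℝ) = Real.log 277 - (Real.log 2 + Real.log 139) := by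
    rw [show (1 - 1 / 278 : ℝ) = (277 : ℝ) / 278 by norm_num, Real.log_div (by norm_num) (by norm_num), hN]
  rw [e, abs_of_pos (by norm_num : (0:ℝ) < 1 / 278)] at h
  obtain ⟨hl, hu⟩ := abs_le.1 h
  simp only [Finset.sum_range_succ, Finset.sum_range_zero] at hl hu
  norm_num at hl hu
  have hb2 := log_two_bounds
  have hb139 := log_139_bounds
  constructor <;> linarith

/-- `5.6383546693332 < log 281 < 5.6383546693343` (from `log(280 / 281)` by 5 terms of the logarithmic series; width 1.1e-12). [folklore] -/
theorem log_281_bounds : (5.6383546693332 : ℝ) < Real.log 281 ∧ Real.log 281 < 5.6383546693343 := by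
  have hx : |(1 / 281 : ℝ)| < 1 := by rw [abs_of_pos (by norm_num)]; norm_num
  have h := Real.abs_log_sub_add_sum_range_le hx 5
  have hN : Real.log (280 : ℝ) = 3 * Real.log 2 + Real.log 5 + Real.log 7 := by
    rw [show (280 : ℝ) = 2 ^ 3 * 5 * 7 by norm_num]
    rw [Real.log_mul (by positivity) (by positivity), Real.log_mul (by positivity) (by positivity)]
    simp only [Real.log_pow]; push_cast; ring
  have e : Real.log (1 - 1 / 281 : ℝ) = (3 * Real.log 2 + Real.log 5 + Real.log 7) - Real.log 281 := by
    rw [show (1 - 1 / 281 : ℝ) = (280 : ℝ) / 281 by norm_num, Real.log_div (by norm_num) (by norm_num), hN]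
  rw [e, abs_of_pos (by norm_num : (0:ℝ) < 1 / 281)] at h
  obtain ⟨hl, hu⟩ := abs_le.1 h
  simp only [Finset.sum_range_succ, Finset.sum_range_zero] at hl hu
  norm_num at hl hu
  have hb2 := log_two_bounds
  have hb5 := log_five_bounds
  have hb7 := log_seven_bounds
  constructor <;> linarith

/-- `5.6454468976427 < log 283 < 5.6454468976440` (from `log(283 / 284)` by 5 terms of the logarithmic series; width 1.3e-12). [folklore] -/
theorem log_283_bounds : (5.6454468976427 : ℝ) < Real.log 283 ∧ Real.log 283 < 5.6454468976440 := by
  have hx : |(1 / 284 : ℝ)| < 1 := by rw [abs_of_pos (by norm_num)]; norm_num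
  have h := Real.abs_log_sub_add_sum_range_le hx 5
  have hN : Real.log (284 : ℝ) = 2 * Real.log 2 + Real.log 71 := by
    rw [show (284 : ℝ) = 2 ^ 2 * 71 by norm_num]
    rw [Real.log_mul (by positivity) (by positivity)]
    simp only [Real.log_pow]; push_cast; ring
  have e : Real.log (1 - 1 / 284 : ℝ) = Real.log 283 - (2 * Real.log 2 + Real.log 71) := by
    rw [show (1 - 1 / 284 : ℝ) = (283 : ℝ) / 284 by norm_num, Real.log_div (by norm_num) (by norm_num), hN]
  rw [e, abs_of_pos (by norm_num : (0:ℝ) < 1 / 284)] at h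
  obtain ⟨hl, hu⟩ := abs_le.1 h
  simp only [Finset.sum_range_succ, Finset.sum_range_zero] at hl hu
  norm_num at hl hu
  have hb2 := log_two_bounds
  have hb71 := log_seventyone_bounds
  constructor <;> linarith

/-- `5.6801726090164 < log 293 < 5.6801726090178` (from `log(292 / 293)` by 5 terms of the logarithmic series; width 1.4e-12). [folklore] -/
theorem log_293_bounds : (5.6801726090164 : ℝ) < Real.log 293 ∧ Real.log 293 < 5.6801726090178 := by
  have hx : |(1 / 293 : ℝ)| < 1 := by rw [abs_of_pos (by norm_num)]; norm_num
  have h := Real.abs_log_sub_add_sum_range_le hx 5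
  have hN : Real.log (292 : ℝ) = 2 * Real.log 2 + Real.log 73 := by
    rw [show (292 : ℝ) = 2 ^ 2 * 73 by norm_num]
    rw [Real.log_mul (by positivity) (by positivity)]
    simp only [Real.log_pow]; push_cast; ring
  have e : Real.log (1 - 1 / 293 : ℝ) = (2 * Real.log 2 + Real.log 73) - Real.log 293 := by
    rw [show (1 - 1 / 293 : ℝ) = (292 : ℝ) / 293 by norm_num, Real.log_div (by norm_num) (by norm_num), hN]
  rw [e, abs_of_pos (by norm_num : (0:ℝ) < 1 / 293)] at h
  obtain ⟨hl, hu⟩ := abs_le.1 h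
  simp only [Finset.sum_range_succ, Finset.sum_range_zero] at hl hu
  norm_num at hl hu
  have hb2 := log_two_bounds
  have hb73 := log_seventythree_bounds
  constructor <;> linarith

/-- `5.7268477475867 < log 307 < 5.7268477475880` (from `log(306 / 307)` by 5 terms of the logarithmic series; width 1.3e-12). [folklore] -/
theorem log_307_bounds : (5.7268477475867 : ℝ) < Real.log 307 ∧ Real.log 307 < 5.7268477475880 := by
  have hx : |(1 / 307 : ℝ)| < 1 := by rw [abs_of_pos (by norm_num)]; norm_num
  have h := Real.abs_log_sub_add_sum_range_le hx 5
  have hN : Real.log (306 : ℝ) = Real.log 2 + 2 * Real.log 3 + Real.log 17 := by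
    rw [show (306 : ℝ) = 2 * 3 ^ 2 * 17 by norm_num]
    rw [Real.log_mul (by positivity) (by positivity), Real.log_mul (by positivity) (by positivity)]
    simp only [Real.log_pow]; push_cast; ring
  have e : Real.log (1 - 1 / 307 : ℝ) = (Real.log 2 + 2 * Real.log 3 + Real.log 17) - Real.log 307 := by
    rw [show (1 - 1 / 307 : ℝ) = (306 : ℝ) / 307 by norm_num, Real.log_div (by norm_num) (by norm_num), hN]
  rw [e, abs_of_pos (by norm_num : (0:ℝ) < 1 / 307)] at h
  obtain ⟨hl, hu⟩ := abs_le.1 h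
  simp only [Finset.sum_range_succ, Finset.sum_range_zero] at hl hu
  norm_num at hl hu
  have hb2 := log_two_bounds
  have hb3 := log_three_bounds
  have hb17 := log_seventeen_bounds
  constructor <;> linarith

/-- `5.7397929121788 < log 311 < 5.7397929121799` (from `log(310 / 311)` by 5 terms of the logarithmic series; width 1.1e-12). [folklore] -/
theorem log_311_bounds : (5.7397929121788 : ℝ) < Real.log 311 ∧ Real.log 311 < 5.7397929121799 := by
  have hx : |(1 / 311 : ℝ)| < 1 := by rw [abs_of_pos (by norm_num)]; norm_num
  have h := Real.abs_log_sub_add_sum_range_le hx 5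
  have hN : Real.log (310 : ℝ) = Real.log 2 + Real.log 5 + Real.log 31 := by
    rw [show (310 : ℝ) = 2 * 5 * 31 by norm_num]
    rw [Real.log_mul (by positivity) (by positivity), Real.log_mul (by positivity) (by positivity)]
  have e : Real.log (1 - 1 / 311 : ℝ) = (Real.log 2 + Real.log 5 + Real.log 31) - Real.log 311 := by
    rw [show (1 - 1 / 311 : ℝ) = (310 : ℝ) / 311 by norm_num, Real.log_div (by norm_num) (by norm_num), hN]
  rw [e, abs_of_pos (by norm_num : (0:ℝ) < 1 / 311)] at h
  obtain ⟨hl, hu⟩ := abs_le.1 h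
  simp only [Finset.sum_range_succ, Finset.sum_range_zero] at hl hu
  norm_num at hl hu
  have hb2 := log_two_bounds
  have hb5 := log_five_bounds
  have hb31 := log_thirtyone_bounds
  constructor <;> linarith

/-- `5.7462031905394 < log 313 < 5.7462031905412` (from `log(313 / 314)` by 5 terms of the logarithmic series; width 1.8e-12). [folklore] -/
theorem log_313_bounds : (5.7462031905394 : ℝ) < Real.log 313 ∧ Real.log 313 < 5.7462031905412 := by
  have hx : |(1 / 314 : ℝ)| < 1 := by rw [abs_of_pos (by norm_num)]; norm_num
  have h := Real.abs_log_sub_add_sum_range_le hx 5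
  have hN : Real.log (314 : ℝ) = Real.log 2 + Real.log 157 := by
    rw [show (314 : ℝ) = 2 * 157 by norm_num]
    rw [Real.log_mul (by positivity) (by positivity)]
  have e : Real.log (1 - 1 / 314 : ℝ) = Real.log 313 - (Real.log 2 + Real.log 157) := by
    rw [show (1 - 1 / 314 : ℝ) = (313 : ℝ) / 314 by norm_num, Real.log_div (by norm_num) (by norm_num), hN]
  rw [e, abs_of_pos (by norm_num : (0:ℝ) < 1 / 314)] at h
  obtain ⟨hl, hu⟩ := abs_le.1 h
  simp only [Finset.sum_range_succ, Finset.sum_range_zero] at hl hu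
  norm_num at hl hu
  have hb2 := log_two_bounds
  have hb157 := log_157_bounds
  constructor <;> linarith

/-- `5.7589017738766 < log 317 < 5.7589017738782` (from `log(316 / 317)` by 5 terms of the logarithmic series; width 1.6e-12). [folklore] -/
theorem log_317_bounds : (5.7589017738766 : ℝ) < Real.log 317 ∧ Real.log 317 < 5.7589017738782 := by
  have hx : |(1 / 317 : ℝ)| < 1 := by rw [abs_of_pos (by norm_num)]; norm_num
  have h := Real.abs_log_sub_add_sum_range_le hx 5
  have hN : Real.log (316 : ℝ) = 2 * Real.log 2 + Real.log 79 := by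
    rw [show (316 : ℝ) = 2 ^ 2 * 79 by norm_num]
    rw [Real.log_mul (by positivity) (by positivity)]
    simp only [Real.log_pow]; push_cast; ring
  have e : Real.log (1 - 1 / 317 : ℝ) = (2 * Real.log 2 + Real.log 79) - Real.log 317 := by
    rw [show (1 - 1 / 317 : ℝ) = (316 : ℝ) / 317 by norm_num, Real.log_div (by norm_num) (by norm_num), hN]
  rw [e, abs_of_pos (by norm_num : (0:ℝ) < 1 / 317)] at h
  obtain ⟨hl, hu⟩ := abs_le.1 h
  simp only [Finset.sum_range_succ, Finset.sum_range_zero] at hl hu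
  norm_num at hl hu
  have hb2 := log_two_bounds
  have hb79 := log_seventynine_bounds
  constructor <;> linarith

/-- `5.8021183753764 < log 331 < 5.8021183753780` (from `log(331 / 332)` by 5 terms of the logarithmic series; width 1.6e-12). [folklore] -/
theorem log_331_bounds : (5.8021183753764 : ℝ) < Real.log 331 ∧ Real.log 331 < 5.8021183753780 := by
  have hx : |(1 / 332 : ℝ)| < 1 := by rw [abs_of_pos (by norm_num)]; norm_num
  have h := Real.abs_log_sub_add_sum_range_le hx 5
  have hN : Real.log (332 : ℝ) = 2 * Real.log 2 + Real.log 83 := by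
    rw [show (332 : ℝ) = 2 ^ 2 * 83 by norm_num]
    rw [Real.log_mul (by positivity) (by positivity)]
    simp only [Real.log_pow]; push_cast; ring
  have e : Real.log (1 - 1 / 332 : ℝ) = Real.log 331 - (2 * Real.log 2 + Real.log 83) := by
    rw [show (1 - 1 / 332 : ℝ) = (331 : ℝ) / 332 by norm_num, Real.log_div (by norm_num) (by norm_num), hN]
  rw [e, abs_of_pos (by norm_num : (0:ℝ) < 1 / 332)] at h
  obtain ⟨hl, hu⟩ := abs_le.1 h
  simp only [Finset.sum_range_succ, Finset.sum_range_zero] at hl hu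
  norm_num at hl hu
  have hb2 := log_two_bounds
  have hb83 := log_eightythree_bounds
  constructor <;> linarith

/-- `5.8200829303518 < log 337 < 5.8200829303532` (from `log(337 / 338)` by 5 terms of the logarithmic series; width 1.4e-12). [folklore] -/
theorem log_337_bounds : (5.8200829303518 : ℝ) < Real.log 337 ∧ Real.log 337 < 5.8200829303532 := by
  have hx : |(1 / 338 : ℝ)| < 1 := by rw [abs_of_pos (by norm_num)]; norm_num
  have h := Real.abs_log_sub_add_sum_range_le hx 5
  have hN : Real.log (338 : ℝ) = Real.log 2 + 2 * Real.log 13 := by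
    rw [show (338 : ℝ) = 2 * 13 ^ 2 by norm_num]
    rw [Real.log_mul (by positivity) (by positivity)]
    simp only [Real.log_pow]; push_cast; ring
  have e : Real.log (1 - 1 / 338 : ℝ) = Real.log 337 - (Real.log 2 + 2 * Real.log 13) := by
    rw [show (1 - 1 / 338 : ℝ) = (337 : ℝ) / 338 by norm_num, Real.log_div (by norm_num) (by norm_num), hN]
  rw [e, abs_of_pos (by norm_num : (0:ℝ) < 1 / 338)] at h
  obtain ⟨hl, hu⟩ := abs_le.1 h
  simp only [Finset.sum_range_succ, Finset.sum_range_zero] at hl hu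
  norm_num at hl hu
  have hb2 := log_two_bounds
  have hb13 := log_thirteen_bounds
  constructor <;> linarith

/-- `5.8493247799463 < log 347 < 5.8493247799477` (from `log(346 / 347)` by 5 terms of the logarithmic series; width 1.4e-12). [folklore] -/
theorem log_347_bounds : (5.8493247799463 : ℝ) < Real.log 347 ∧ Real.log 347 < 5.8493247799477 := by
  have hx : |(1 / 347 : ℝ)| < 1 := by rw [abs_of_pos (by norm_num)]; norm_num
  have h := Real.abs_log_sub_add_sum_range_le hx 5
  have hN : Real.log (346 : ℝ) = Real.log 2 + Real.log 173 := by
    rw [show (346 : ℝ) = 2 * 173 by norm_num]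
    rw [Real.log_mul (by positivity) (by positivity)]
  have e : Real.log (1 - 1 / 347 : ℝ) = (Real.log 2 + Real.log 173) - Real.log 347 := by
    rw [show (1 - 1 / 347 : ℝ) = (346 : ℝ) / 347 by norm_num, Real.log_div (by norm_num) (by norm_num), hN]
  rw [e, abs_of_pos (by norm_num : (0:ℝ) < 1 / 347)] at h
  obtain ⟨hl, hu⟩ := abs_le.1 h
  simp only [Finset.sum_range_succ, Finset.sum_range_zero] at hl hu
  norm_num at hl hu
  have hb2 := log_two_bounds
  have hb173 := log_173_bounds
  constructor <;> linarith

end Summit.RiemannHypothesis.RiemannHypothesis.Theorems.DbrWall.LogTable
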